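import Summits.CriticalPhenomena.Ising3DConformalLimit.Theses.MonotoneRG
import Summits.CriticalPhenomena.Ising3DConformalLimit.Theorems.EnergyNotSigmaSquaredMoebiusLimitExistsDefs
import HarnessLib

/-!
# Vocabulary of line `monotone-blocking-port` for crux `ExistsScaleCovariantLimit` (stmt-CriticalPhenomena-1981)

Route `HyperoctahedralRP` (sub-problem `CriticalPhenomena/Ising3DConformalLimit`), crux
`Summit.CriticalPhenomena.Ising3DConformalLimit.Theses.HyperoctahedralRP.ExistsScaleCovariantLimit` (item
stmt-CriticalPhenomena-1981, shared verbatim by 14 routes). This file is the **definitions module** of the checked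
skeleton `Cruxes/ExistsScaleCovariantLimit/Lines/monotone_blocking_port.lean` (crux-plan
`planner-cruxplan-stmt-CriticalPhenomena-1981-monotone-blocking-po-0`, v2b; lead
`prover-line-stmt-CriticalPhenomena-1981-a1-0`, skeleton v3 = the planner's composition with stub S4 reshaped into
a lattice half and an analysis half). It carries, sorry-free and verbatim from the skeleton, the line's VOCABULARY —
the block `cube L = {0,…,L-1}³`, the block covariance `blockCov L k = C(L;k) = Σ_{x,y ∈ cube L} ⟨σ_xσ_{y+Lk}⟩_{β_c}`
(`C(L;0) = V(L)`, the block variance), the normalisation-free block moments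
`critBlockMoment n L k = R_n(L;k) = Σ_{xᵢ ∈ cube L} ⟨∏ᵢ σ_{xᵢ+Lkᵢ}⟩_{β_c} / V(L)^{n/2}` of the ONE critical
nearest-neighbour Ising measure on `ℤ³` — the four auxiliary statements `BlockTwoLimits`, `BlockLimits`,
`TwoPointScaling`, `IntMeshConvergence`, and the seven stub STATEMENTS `Sig.stub_*` (each a `def … : Prop`), so
that the stub helper files `Theorems/HyperoctahedralRPExistsScaleCovariantLimit<StubName>.lean` (each proving
`theorem <stubName> : Sig.<stubName>` by name, `--supports stmt-CriticalPhenomena-1981`) and the closing skeleton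
share ONE copy of every object. NOTHING in this file is asserted: every `def … : Prop` is a statement to be
proved by a registered stub or by the skeleton's glue (two of them, `Sig.stub_monotoneBlockingTwo` and
`Sig.stub_monotoneBlockingHigher`, are the line's CONJECTURE BM — eventual monotone blocking — and are open).

The stubs (skeleton v3): S1 `stub_monotoneBlockingTwo` (BM₂, open), S2 `stub_monotoneBlockingHigher` (BM at
orders `≥ 3`, open), S3 `stub_blockMomentBounded` (Griffiths + Newman's Gaussian inequality), S4a
`stub_blockCovAlgebra` (positivity, monotonicity, the sub-cube decomposition `V(jL) = Σ_{a,b ∈ cube j} C(L; b−a)`,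
the `n = 2` block moment is the ratio `C(L;k₁−k₀)/V(L)`), S4b `stub_blockCovTwoPointBounds` (the
Messager–Miracle-Solé `ℓ¹/ℓ^∞` sandwich `L⁶ g((j+3)L) ≤ C(L; je₀) ≤ L⁶ g((j−1)L)` and the top-heavy-scales lemma
`ε V(L) ≤ L⁶ g(pL)` frequently, from the infrared lower bound `⟨σ₀σ_x⟩ ≥ c‖x‖⁻²`), S4c
`stub_twoPointScaling_of_lattice` (pure analysis: S4a ∧ S4b ∧ block two-point limits ⟹ `TwoPointScaling`), S5
`stub_intMesh_of_blockLimits` (de-smearing). The planner's S4 `BlockTwoLimits → TwoPointScaling` is kept as the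
statement `Sig.stub_twoPointScaling_of_blockTwoLimits`, now GLUE (S4c applied to S4a, S4b).

Sources: A. Messager, S. Miracle-Solé, J. Stat. Phys. 17 (1977) (monotonicity); C. M. Newman, Z. Wahrsch. 33 (1975)
(Gaussian inequality); M. Aizenman, H. Duminil-Copin, Ann. Math. 194 (2021), arXiv:1912.07973 §5–§6; N. H. Bingham,
C. M. Goldie, J. L. Teugels, *Regular Variation* (CUP 1987) §1.9–1.10 (the regular-variation reading of
`TwoPointScaling`); crux idea card `Ideas/monotone-blocking-port.md` (conjecture BM, MC certification).
-/

noncomputable section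

namespace Summit.CriticalPhenomena.Ising3DConformalLimit.Cruxes.ExistsScaleCovariantLimit.MonotoneBlockingPort

open Literature.Probability.LatticeModels Filter Set
open scoped Topology BigOperators
open Summit.CriticalPhenomena.Ising3DConformalLimit.MoebiusLimitExistsOnlyInteraction (rhoPin)
open Summit.CriticalPhenomena.Ising3DConformalLimit.Theses

/-! ## Objects -/

/-- The cube `{0,…,L-1}³ ⊂ ℤ³` — the block of side `L` anchored at the origin (`cube 0 = ∅`). -/
def cube (L : ℕ) : Finset (Site 3) := Fintype.piFinset fun _ => Finset.Ico (0 : ℤ) L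

/-- Block covariance `C(L; k) = Σ_{x,y ∈ cube L} ⟨σ_x σ_{y + L k}⟩_{β_c}` of the critical n.n. Ising model on `ℤ³`
(`= E[B_L(0) B_L(k)]`, `B_L(k) = Σ_{x ∈ cube L} σ_{x + Lk}`); `C(L; 0) = V(L)` is the block variance. -/
def blockCov (L : ℕ) (k : Site 3) : ℝ :=
  ∑ x ∈ cube L, ∑ y ∈ cube L, criticalTwoPoint 3 (y - x + (L : ℤ) • k)

/-- Normalised block `n`-point moment `R_n(L; k⃗) = Σ_{xᵢ ∈ cube L} ⟨∏ᵢ σ_{xᵢ + L kᵢ}⟩_{β_c} / V(L)^{n/2}`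
(`= E[∏ᵢ B_L(kᵢ)] / E[B_L(0)²]^{n/2}`; at `n = 2`, `k⃗ = (k₀, k₁)`: the block correlation RATIO
`ρ(L; k₁ − k₀) = C(L; k₁ − k₀)/V(L) ∈ [0, 1]`). No renormalisation constant, no continuum object. The exponent is the
real power `V(L) ^ ((n:ℝ)/2)`; junk values: `R_n(0; k⃗) = 0` for `n ≥ 1`, `R_0(L; ·) = 1`. -/
def critBlockMoment (n L : ℕ) (k : Fin n → Site 3) : ℝ :=
  (∑ x ∈ Fintype.piFinset (fun _ : Fin n => cube L), criticalCorr 3 n (fun i => x i + (L : ℤ) • k i)) /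
    blockCov L 0 ^ ((n : ℝ) / 2)

/-! ## Auxiliary statements (plain `Prop`s; nothing asserted) -/

/-- Every block TWO-point ratio at distinct block positions converges as `L → ∞` (the `n = 2` output of BM₂).
A statement, not asserted. -/
def BlockTwoLimits : Prop :=
  ∀ k : Fin 2 → Site 3, Function.Injective k →
    ∃ r : ℝ, Tendsto (fun L : ℕ => critBlockMoment 2 L k) atTop (𝓝 r)

/-- Every block moment of order `≥ 2` at pairwise distinct block positions converges as `L → ∞`.
A statement, not asserted. -/
def BlockLimits : Prop :=
  ∀ n : ℕ, 2 ≤ n → ∀ k : Fin n → Site 3, Function.Injective k →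
    ∃ M : ℝ, Tendsto (fun L : ℕ => critBlockMoment n L k) atTop (𝓝 M)

/-- TWO-POINT SCALING: (i) `m⁶ g(m)/V(m) → Φ > 0` and (ii) `g(jm)/g(m) → r_j > 0` for every integer `j ≥ 1`
(`g(m) = ⟨σ₀σ_{m e₀}⟩_{β_c}`, `V(m) = C(m;0)`): the axial critical two-point function is REGULARLY VARYING along
integer dilations and the block variance is `V(m) ≍ Φ⁻¹ m⁶ g(m)` — `η(3)` exists in the regular-variation sense.
A statement, not asserted. -/
def TwoPointScaling : Prop :=
  (∃ Φ : ℝ, 0 < Φ ∧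
    Tendsto (fun m : ℕ => (m : ℝ) ^ 6 * criticalTwoPoint 3 (Pi.single 0 (m : ℤ)) / blockCov m 0) atTop (𝓝 Φ)) ∧
  (∀ j : ℕ, 1 ≤ j → ∃ r : ℝ, 0 < r ∧
    Tendsto (fun m : ℕ => criticalTwoPoint 3 (Pi.single 0 ((j * m : ℕ) : ℤ)) /
      criticalTwoPoint 3 (Pi.single 0 (m : ℤ))) atTop (𝓝 r))

/-- INTEGER-MESH CONVERGENCE of the pinned zoom at integer configurations — verbatim the right-hand side of the
landed `TwoHierarchies.crux_iff_intMeshConvergence` (p123864): `m ↦ ⟨∏ᵢσ_{m yᵢ}⟩_{β_c}/g(m)^{n/2}` converges.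
A statement, not asserted (it is equivalent to the crux). -/
def IntMeshConvergence : Prop :=
  ∀ (n : ℕ) (y : Fin n → EuclideanSpace ℝ (Fin 3)), y ∈ NonCoincident 3 n →
    (∀ i j, ∃ z : ℤ, y i j = (z : ℝ)) →
    ∃ L : ℝ, Tendsto (fun m : ℕ => rescaledCorrelator (criticalCorr 3) rhoPin n (1 / (m : ℝ)) y) atTop (𝓝 L)

/-! ## Stub STATEMENTS `Sig.stub_*` (each a `def … : Prop`; nothing asserted here) -/

/-- **S1 statement — BM₂, the `n = 2` conjecture (load-bearing, FIRST milestone).** For every pair of DISTINCT block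
positions `(k₀, k₁)` the block correlation ratio `L ↦ ρ(L; k₁ − k₀) = C(L; k₁−k₀)/V(L)` is EVENTUALLY monotone.
OPEN (conjecture BM₂ of the card `Ideas/monotone-blocking-port.md`): strictly stronger than convergence; violated
for `β < β_c`, for the log-periodic GFF and for the discretely self-similar family `W_ε`; exact for the lattice GFF;
Monte-Carlo certified two-sidedly on 11 steps, 0 refuted (card). -/
def Sig.stub_monotoneBlockingTwo : Prop :=
  ∀ k : Fin 2 → Site 3, Function.Injective k → ∃ L₀ : ℕ,
    MonotoneOn (fun L : ℕ => critBlockMoment 2 L k) (Set.Ici L₀) ∨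
      AntitoneOn (fun L : ℕ => critBlockMoment 2 L k) (Set.Ici L₀)

/-- **S2 statement — BM at orders `n ≥ 3` (load-bearing, HARDEST).** For every `n ≥ 3` and every INJECTIVE offset
vector `k⃗ ∈ (ℤ³)ⁿ`, `L ↦ R_n(L; k⃗)` is eventually monotone. Odd orders vanish identically; the content is even
`n ≥ 4`. OPEN (conjecture BM of the card; no proof technology). -/
def Sig.stub_monotoneBlockingHigher : Prop :=
  ∀ n : ℕ, 3 ≤ n → ∀ k : Fin n → Site 3, Function.Injective k → ∃ L₀ : ℕ,
    MonotoneOn (fun L : ℕ => critBlockMoment n L k) (Set.Ici L₀) ∨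
      AntitoneOn (fun L : ℕ => critBlockMoment n L k) (Set.Ici L₀)

/-- **S3 statement — uniform bounds.** `|R_n(L; k⃗)| ≤ C(n, k⃗)` for all `L ≥ 1`: odd `n` vanish
(`criticalCorr_eq_zero_of_odd`); even `n = 2m`: Griffiths I (`criticalCorr_nonneg'`) and Newman's Gaussian
inequality for the critical state (`criticalCorr_le_pairingSum`) bound the numerator by
`Σ_pairings ∏ C(L; k_b − k_a) ≤ (2m−1)!! V(L)^m`, using `C(L;k) ≤ V(L)` (`2 B₀B_k ≤ B₀² + B_k²` integrated against
a plus Gibbs measure, `criticalCorr_eq_integral_spinMonomial`, and `E[B_k²] = V(L)`). -/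
def Sig.stub_blockMomentBounded : Prop :=
  ∀ (n : ℕ) (k : Fin n → Site 3), ∃ C : ℝ, ∀ L : ℕ, 1 ≤ L → |critBlockMoment n L k| ≤ C

/-- **S4a statement — block covariance algebra (lattice bookkeeping).** (1) `V(L) > 0` for `L ≥ 1`
(`⟨σ₀σ₀⟩ = 1`, Griffiths); (2) `L ↦ V(L)` is monotone (`cube L ⊆ cube (L+1)`, `⟨σσ⟩ ≥ 0`); (3) the SUB-CUBE
DECOMPOSITION `V(jL) = Σ_{a,b ∈ cube j} C(L; b − a)` (`cube (jL) = ⊔_{a ∈ cube j} (cube L + L a)`); (4) the `n = 2`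
block moment is the ratio `R_2(L; (k₀,k₁)) = C(L; k₁ − k₀)/V(L)` (`criticalCorr_two_pair`; both sides `0` at
`L = 0`). -/
def Sig.stub_blockCovAlgebra : Prop :=
  (∀ L : ℕ, 1 ≤ L → 0 < blockCov L 0) ∧
  (Monotone fun L : ℕ => blockCov L 0) ∧
  (∀ j L : ℕ, blockCov (j * L) 0 = ∑ a ∈ cube j, ∑ b ∈ cube j, blockCov L (b - a)) ∧
  (∀ (L : ℕ) (k : Fin 2 → Site 3), critBlockMoment 2 L k = blockCov L (k 1 - k 0) / blockCov L 0)

/-- **S4b statement — block covariance versus the axial two-point function (Messager–Miracle-Solé + infrared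
bound).** (1) THE SANDWICH: for `j ≥ 1` and every `L`, `L⁶ g((j+3)L) ≤ C(L; j e₀) ≤ L⁶ g((j−1)L)`
(`g(m) = ⟨σ₀σ_{me₀}⟩_{β_c}`): every `z = y − x + jL e₀`, `x, y ∈ cube L`, has `‖z‖_∞ ≥ z₀ > (j−1)L` and
`‖z‖₁ ≤ (j+3)L`, and `g(‖z‖₁) ≤ ⟨σ₀σ_z⟩ ≤ g(‖z‖_∞)` (`twoPointPlus_single_sum_le` after reflecting into the
positive orthant / `twoPointPlus_le_axis_of_mem_sphere`, then `criticalTwoPoint_axis_antitone`). (2) TOP-HEAVY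
SCALES: for every `p ≥ 1` there is `ε > 0` with `ε V(L) ≤ L⁶ g(pL)` for infinitely many `L` — otherwise, with
`S(R) = Σ_{‖z‖_∞ ≤ R} ⟨σ₀σ_z⟩`, `V(L) ≤ L³ S(L)` and the shell bound `S(2pL) − S(pL) ≤ 125 p³L³ g(pL)` give
`S(2pL) ≤ (1 + 125p³ε) S(pL)` eventually, so `S(p 2^k L₀) ≤ (1+125p³ε)^k S(pL₀)`, against `S(R) ≥ 8cR` from the
infrared lower bound `⟨σ₀σ_z⟩ ≥ c‖z‖_∞⁻²` (`criticalTwoPoint_bounds_holds`) once `125 p³ ε < 1`. -/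
def Sig.stub_blockCovTwoPointBounds : Prop :=
  (∀ j L : ℕ, 1 ≤ j →
    (L : ℝ) ^ 6 * criticalTwoPoint 3 (Pi.single 0 (((j + 3) * L : ℕ) : ℤ)) ≤ blockCov L (Pi.single 0 (j : ℤ)) ∧
      blockCov L (Pi.single 0 (j : ℤ)) ≤ (L : ℝ) ^ 6 * criticalTwoPoint 3 (Pi.single 0 (((j - 1) * L : ℕ) : ℤ))) ∧
  (∀ p : ℕ, 1 ≤ p → ∃ ε : ℝ, 0 < ε ∧
    ∃ᶠ L : ℕ in atTop, ε * blockCov L 0 ≤ (L : ℝ) ^ 6 * criticalTwoPoint 3 (Pi.single 0 ((p * L : ℕ) : ℤ)))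

/-- **S4c statement — two-point scaling from the lattice facts and the block two-point limits (pure analysis).**
`S4a → S4b → BlockTwoLimits → TwoPointScaling`. Route (`g` antitone and positive on the axis, tree facts):
`V(jL)/V(L) = Σ_{a,b ∈ cube j} ρ(L; b−a) → c_j ≥ 1` (diagonal terms `1`, off-diagonal ratios converge by
`BlockTwoLimits`); with `φ(m) = m⁶ g(m)/V(m)` the sandwich gives, for `j ≥ 2`,
`limsup_L φ((j+3)L) ≤ A_j = (j+3)⁶ ρ_∞(je₀)/c_{j+3}` and `liminf_L φ((j−1)L) ≥ B_j = (j−1)⁶ ρ_∞(je₀)/c_{j−1}`;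
monotonicity of `g` and `V` transfers bounds along multiples `pL` to the full sequence
(`φ(m) ≤ ((L+1)/L)⁶ φ(pL)`, `φ(m) ≥ (L/(L+1))⁶ φ(p(L+1))` for `pL ≤ m < p(L+1)`), so
`B_j ≤ liminf φ ≤ limsup φ ≤ A_j ≤ ((j+3)/(j−1))⁶ B_j` (`c_{j−1} ≤ c_{j+3}`, `V` monotone); `B_2 = ρ_∞(2e₀) > 0` by
the top-heavy lemma at `p = 5`; letting `j → ∞`, `φ → Φ = sup_j B_j > 0`, and then
`g(jm)/g(m) = (φ(jm)/φ(m)) j⁻⁶ V(jm)/V(m) → j⁻⁶ c_j > 0`. -/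
def Sig.stub_twoPointScaling_of_lattice : Prop :=
  Sig.stub_blockCovAlgebra → Sig.stub_blockCovTwoPointBounds → BlockTwoLimits → TwoPointScaling

/-- **S4 statement (planner's v2b stub, now GLUE in skeleton v3) — block two-point limits force regular variation of
the axial two-point function:** `BlockTwoLimits → TwoPointScaling` (S4c applied to S4a and S4b).
[BinghamGoldieTeugels1987 §1.9–1.10; MessagerMiracleSoleJSP1977] -/
def Sig.stub_twoPointScaling_of_blockTwoLimits : Prop :=
  BlockTwoLimits → TwoPointScaling

/-- **S5 statement — de-smearing (provable GIVEN its hypotheses).** `BlockLimits → TwoPointScaling →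
MonotoneRG.UniformRegularity → IntMeshConvergence`. The equicontinuity input (item 4658) is a HYPOTHESIS of this
glue statement, DERIVED in the composition from the `n = 2` output (D6 + `uniformRegularity_of_doubling`), not a
stub. Route: `ρ★ = rhoPin` (`rhoStar_eq_rhoPin`); by equicontinuity (clause (b) of `UniformRegularity`) on a small
closed ball around `y` inside `NonCoincident`, for `j` large and `m ≥ m₀(j, ε)`, `L = ⌊m/j⌋`, the pinned zoom at `y`
and mesh `1/m` is within `ε` of its average over the block configurations `((xᵢ + L·(j yᵢ))/m)ᵢ`, `xᵢ ∈ cube L`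
(lattice-exact at mesh `1/m`, cf. `latticeApprox_one_div_natCast_of_int`; each within `√3/j + ‖y‖ j/m` of `y`),
and that average EQUALS `R_n(L; j y⃗) · (V(L)/(L⁶ g(m)))^{n/2}`, which converges: `R_n → M` (`BlockLimits`, `j y⃗`
injective, `n ≥ 2`), `V(L)/(L⁶ g(m)) = [V(L)/(L⁶g(L))]·[g(L)/g(jL)]·[g(jL)/g(m)] → Φ⁻¹ r_j⁻¹ · 1`
(`TwoPointScaling` (i),(ii); `g(jL + a)/g(jL) → 1` for `0 ≤ a < j` by `criticalTwoPoint_axis_ratio_tendsto_one` and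
antitonicity). Hence the sequence is Cauchy. Orders `0`/`1`/odd are constant/zero (`criticalCorr_eq_zero_of_odd`). -/
def Sig.stub_intMesh_of_blockLimits : Prop :=
  BlockLimits → TwoPointScaling → MonotoneRG.UniformRegularity → IntMeshConvergence

/-! ## Elementary facts about the block (registered glue sub-goal `glue_cubeFacts`, proved here) -/

/-- GLUE statement — the four elementary facts about `cube` every stub file uses: membership, cardinality `L³`,
`cube 0 = ∅`, and `V(L) = C(L;0) = Σ_{x,y ∈ cube L} ⟨σ_xσ_y⟩_{β_c}` with the offset term removed. -/
def Sig.glue_cubeFacts : Prop :=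
  (∀ (L : ℕ) (x : Site 3), x ∈ cube L ↔ ∀ i, 0 ≤ x i ∧ x i < (L : ℤ)) ∧
  (∀ L : ℕ, (cube L).card = L ^ 3) ∧
  (cube 0 = ∅) ∧
  (∀ L : ℕ, blockCov L 0 = ∑ x ∈ cube L, ∑ y ∈ cube L, criticalTwoPoint 3 (y - x))

/-- The four elementary facts about `cube` (membership, `|cube L| = L³`, `cube 0 = ∅`, `V(L) = Σ_{x,y} ⟨σ_xσ_y⟩`).
[folklore] -/
theorem glue_cubeFacts : Sig.glue_cubeFacts := by
  refine ⟨fun L x => ?_, fun L => ?_, ?_, fun L => ?_⟩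
  · simp [cube, Fintype.mem_piFinset]
  · rw [cube, Fintype.card_piFinset_const, Int.card_Ico]
    simp
  · ext x
    simp [cube]
  · simp [blockCov]

/-- Membership in the block: `x ∈ cube L ↔ ∀ i, 0 ≤ xᵢ < L`. [folklore] -/
theorem mem_cube {L : ℕ} {x : Site 3} : x ∈ cube L ↔ ∀ i, 0 ≤ x i ∧ x i < (L : ℤ) :=
  glue_cubeFacts.1 L x

/-- `|cube L| = L³`. [folklore] -/
theorem card_cube (L : ℕ) : (cube L).card = L ^ 3 :=
  glue_cubeFacts.2.1 L

/-- `cube 0 = ∅`. [folklore] -/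
theorem cube_zero : cube 0 = ∅ :=
  glue_cubeFacts.2.2.1

/-- `V(L) = C(L; 0) = Σ_{x,y ∈ cube L} ⟨σ_xσ_y⟩_{β_c}`. [folklore] -/
theorem blockCov_zero_eq (L : ℕ) : blockCov L 0 = ∑ x ∈ cube L, ∑ y ∈ cube L, criticalTwoPoint 3 (y - x) :=
  glue_cubeFacts.2.2.2 L

end Summit.CriticalPhenomena.Ising3DConformalLimit.Cruxes.ExistsScaleCovariantLimit.MonotoneBlockingPort

end
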